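import Summits.CriticalPhenomena.PercolationContinuityZ3.Theses.PercBurnResprinkle
import Literature.Barriers.CriticalPhenomena.SlabLimitUniformControl
import Literature.Probability.Percolation.ConnectivityProofs

/-!
# Triage scratch (crux-triage r1, triager 3) — typed defect of card `planar-trace-sharpness`

The card's typed "crux of the line" `TraceNotSupercritical ε` (copied VERBATIM from
`Cruxes/VacantSetPercolates/Sketch-ideator3.lean`, together with the definitions it uses) does not
encode the side condition `n ≥ C ξ(p) log n`; without it, it follows from the SUMMIT conjunct
`PercolationContinuityZ3` with `n = 1`: `P_p(TraceAnnulusCrossing 1) ≤ 9 θ(p)` and `θ(p) → 0` as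
`p ↓ p_c` when `θ(p_c) = 0` (tree: `exists_theta_zd_lt_of_eq_zero`).  Hence
`TraceNotSupercritical ε₀ → VacantSetPercolates` cannot be the card's mechanism.
-/

namespace TriageScratch

open Literature.Probability.Percolation Literature.Probability.LatticeModels MeasureTheory

abbrev V3 : Type := Site 3

/-- verbatim from Sketch-ideator3.lean -/
def vacantSet (ω : BondConfig V3) : Set V3 := {y | (openCluster ω y).Finite}
/-- verbatim from Sketch-ideator3.lean -/
def plane0 : Set V3 := {x | x 0 = 0}
/-- verbatim from Sketch-ideator3.lean -/
def starAdj (x y : V3) : Prop := x ≠ y ∧ x ∈ plane0 ∧ y ∈ plane0 ∧ ∀ i, |x i - y i| ≤ 1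

/-- verbatim from Sketch-ideator3.lean -/
def TraceAnnulusCrossing (n : ℕ) : Set (BondConfig V3) :=
  {ω | ∃ (l : ℕ) (γ : Fin (l + 1) → V3),
      (∀ i, γ i ∈ plane0 ∧ γ i ∉ vacantSet ω ∧ |γ i 1| ≤ 3 * n ∧ |γ i 2| ≤ 3 * n) ∧
      (|γ 0 1| ≤ n ∧ |γ 0 2| ≤ n) ∧ (|γ (Fin.last l) 1| = 3 * n ∨ |γ (Fin.last l) 2| = 3 * n) ∧
      ∀ i : Fin l, starAdj (γ i.castSucc) (γ i.succ)}

/-- verbatim from Sketch-ideator3.lean -/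
def TraceNotSupercritical (ε : ℝ) : Prop :=
  ∃ p : unitInterval, criticalProb (zdGraph 3) (0 : V3) < (p : ℝ) ∧
    ∃ n : ℕ, 1 ≤ n ∧ (bondPercolation (zdGraph 3) p).real (TraceAnnulusCrossing n) < ε

/-- The nine plane sites of the inner square for `n = 1`. -/
noncomputable def F : Finset V3 := (box 3 1).filter (fun x => x 0 = 0)

theorem traceAnnulusCrossing_one_subset :
    TraceAnnulusCrossing 1 ⊆ ⋃ x ∈ F, percolatesAt x := by
  rintro ω ⟨l, γ, hall, ⟨h1, h2⟩, -, -⟩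
  obtain ⟨hpl, hvac, -, -⟩ := hall 0
  have h0' : γ 0 0 = 0 := hpl
  have h1' := abs_le.1 h1
  have h2' := abs_le.1 h2
  simp only [Set.mem_iUnion]
  refine ⟨γ 0, ?_, ?_⟩
  · simp only [F, Finset.mem_filter, mem_box]
    refine ⟨fun i => ?_, h0'⟩
    fin_cases i
    · show -((1 : ℕ) : ℤ) ≤ γ 0 0 ∧ γ 0 0 ≤ ((1 : ℕ) : ℤ)
      rw [h0']; norm_num
    · show -((1 : ℕ) : ℤ) ≤ γ 0 1 ∧ γ 0 1 ≤ ((1 : ℕ) : ℤ)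
      exact h1'
    · show -((1 : ℕ) : ℤ) ≤ γ 0 2 ∧ γ 0 2 ≤ ((1 : ℕ) : ℤ)
      exact h2'
  · exact hvac

theorem real_traceAnnulusCrossing_one_le (p : unitInterval) :
    (bondPercolation (zdGraph 3) p).real (TraceAnnulusCrossing 1)
      ≤ (F.card : ℝ) * theta (zdGraph 3) (0 : V3) p := by
  calc (bondPercolation (zdGraph 3) p).real (TraceAnnulusCrossing 1)
      ≤ (bondPercolation (zdGraph 3) p).real (⋃ x ∈ F, percolatesAt x) :=
        measureReal_mono traceAnnulusCrossing_one_subset (measure_ne_top _ _)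
    _ ≤ ∑ x ∈ F, (bondPercolation (zdGraph 3) p).real (percolatesAt x) :=
        measureReal_biUnion_finset_le F _
    _ = ∑ x ∈ F, theta (zdGraph 3) (0 : V3) p := by
        refine Finset.sum_congr rfl fun x _ => ?_
        exact theta_zdGraph_eq_theta_zero p x
    _ = (F.card : ℝ) * theta (zdGraph 3) (0 : V3) p := by
        rw [Finset.sum_const, nsmul_eq_mul]

/-- **The typed crux-of-line of `planar-trace-sharpness` is a corollary of the summit conjunct.** -/
theorem traceNotSupercritical_of_continuity (hc : _root_.PercolationContinuityZ3) {ε : ℝ} (hε : 0 < ε) :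
    TraceNotSupercritical ε := by
  have h0 : theta (zdGraph 3) (0 : Site 3) (criticalProbI 3) = 0 := hc
  have hF : (0 : ℝ) < F.card + 1 := by positivity
  obtain ⟨δ, hδ, hθ⟩ := Literature.Barriers.CriticalPhenomena.exists_theta_zd_lt_of_eq_zero 3
    (criticalProbI 3) h0 (div_pos hε hF)
  have hpc1 : criticalProb (zdGraph 3) (0 : Site 3) < 1 := criticalProb_zd_lt_one (by norm_num)
  have hpc0 : 0 ≤ criticalProb (zdGraph 3) (0 : Site 3) := (criticalProb_mem_Icc _ _).1
  set c : ℝ := criticalProb (zdGraph 3) (0 : Site 3) with hc'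
  set q : ℝ := min (c + δ / 2) ((c + 1) / 2) with hq
  have hq0 : 0 ≤ q := le_min (by linarith) (by linarith)
  have hq1 : q ≤ 1 := (min_le_right _ _).trans (by linarith)
  have hqc : c < q := lt_min (by linarith) (by linarith)
  have hqδ : q < c + δ := (min_le_left _ _).trans_lt (by linarith)
  refine ⟨⟨q, hq0, hq1⟩, hqc, 1, le_rfl, ?_⟩
  have hθq : theta (zdGraph 3) (0 : Site 3) ⟨q, hq0, hq1⟩ < ε / (F.card + 1) :=
    hθ ⟨q, hq0, hq1⟩ (by simpa [hc'] using hqδ)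
  have hcard : (0 : ℝ) ≤ F.card := Nat.cast_nonneg _
  calc (bondPercolation (zdGraph 3) ⟨q, hq0, hq1⟩).real (TraceAnnulusCrossing 1)
      ≤ (F.card : ℝ) * theta (zdGraph 3) (0 : V3) ⟨q, hq0, hq1⟩ := real_traceAnnulusCrossing_one_le _
    _ ≤ (F.card : ℝ) * (ε / (F.card + 1)) := mul_le_mul_of_nonneg_left hθq.le hcard
    _ < (F.card + 1) * (ε / (F.card + 1)) := mul_lt_mul_of_pos_right (by linarith) (div_pos hε hF)
    _ = ε := by field_simp

end TriageScratch
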